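import Mathlib
import HarnessLib

/-!
# Tools for the Type-I recurrence theorem of line `efficiency_floor`
# (crux `EfficiencyFloor.ProductionEfficiencyDecay`, stmt-NavierStokesRegularity-22866; `--supports`)

Pure real algebra / one-variable analysis behind
`Theorems/EfficiencyFloorProductionEfficiencyDecayTypeIRecurrence.lean`; no Navier–Stokes content.

* `cubic_law` — the Lu–Doering cubic law from the sharp-exponent stretching envelope of stmt-22995:
  `|S| ≤ c Z^{3/4} P^{3/4}` (`Z` enstrophy, `P` palinstrophy, `S` stretching) gives
  `Ż = 2S − 2νP ≤ (27c⁴/(128ν³)) Z³`, the maximum over `P` (Young's inequality with exponents `4, 4/3`,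
  in polynomial form `(3q+κ)⁴ − 256q³κ = (q−κ)²(81q²+14qκ+κ²) ≥ 0`, as in Ayala 2014, App. A (A.8)).
* `window` — at an instant of `ε₀`-GROWTH, `ε₀Z³ ≤ 2S − 2νP`, the state is near-extremal: `P > 0`,
  `νP ≤ S`, the palinstrophy ratio is pinned to the Lu–Doering window `Z³ ≤ (2c/ε₀)^{4/3} P`,
  `ν⁴P ≤ c⁴Z³`, and the stretching is `ε₁`-EFFICIENT, `ε₁ Z^{3/4}P^{3/4} ≤ S` with `ε₁ = ε₀ν³/(2c³)` —
  exactly the hypothesis of the structural lemma `EfficiencyConcentration` (stmt-23111).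
* `radius_le` — `Z³ ≤ A·P` turns the concentration radius `K√(Z/P)` of stmt-23111 into `K√A/Z`.
* `exists_deriv_le` — mean-value recurrence: `g` differentiable on `[t,T)`, `g(t) > 0`, `g ≤ g(t)/4`
  somewhere in `(t,T)` ⇒ `g' ≤ −g(t)/(2(T−t))` somewhere in `(t,T)`.

Nothing about Navier–Stokes regularity is asserted anywhere in this file. [folklore]
-/

-- the problem directory repeats the summit name (`NavierStokesRegularity/NavierStokesRegularity`)
set_option linter.dupNamespace false

noncomputable section

open Set

namespace Summit.NavierStokesRegularity.NavierStokesRegularity.Theorems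

namespace TypeIRecurrence

/-! ## 1. Algebra of the Lu–Doering envelope -/

/-- `(Z^{3/4} P^{3/4})⁴ = Z³ P³` for `Z, P ≥ 0` (the tree's `rpow_three_quarters_pow_four`, inlined to keep
this tools file import-light). [folklore] -/
theorem envelope_pow_four {Z P : ℝ} (hZ : 0 ≤ Z) (hP : 0 ≤ P) :
    (Z ^ (3 / 4 : ℝ) * P ^ (3 / 4 : ℝ)) ^ 4 = Z ^ 3 * P ^ 3 := by
  have h : ∀ {y : ℝ}, 0 ≤ y → (y ^ (3 / 4 : ℝ)) ^ 4 = y ^ 3 := fun {y} hy => by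
    rw [← Real.rpow_natCast, ← Real.rpow_mul hy]
    norm_num
  rw [mul_pow, h hZ, h hP]

/-- **The Lu–Doering cubic law from the sharp-exponent envelope** (Young/AM–GM in polynomial form):
`|S| ≤ c Z^{3/4} P^{3/4}` with `Z, P ≥ 0`, `c, ν > 0` gives `2S − 2νP ≤ (27c⁴/(128ν³)) Z³`, the
maximum over `P` of `2cZ^{3/4}P^{3/4} − 2νP`. [cite: LuDoering2008, main estimate] -/
theorem cubic_law {c ν Z P S : ℝ} (hc : 0 < c) (hν : 0 < ν) (hZ : 0 ≤ Z) (hP : 0 ≤ P)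
    (hS : |S| ≤ c * Z ^ (3 / 4 : ℝ) * P ^ (3 / 4 : ℝ)) :
    2 * S - 2 * ν * P ≤ 27 * c ^ 4 / (128 * ν ^ 3) * Z ^ 3 := by
  set X : ℝ := Z ^ (3 / 4 : ℝ) * P ^ (3 / 4 : ℝ) with hX
  have hX0 : 0 ≤ X := by positivity
  have hX4 : X ^ 4 = Z ^ 3 * P ^ 3 := envelope_pow_four hZ hP
  have hSX : S ≤ c * X := by
    have := le_abs_self S
    rw [hX, ← mul_assoc]
    linarith
  -- `cX ≤ νP + κ`, `κ = 27c⁴Z³/(256ν³)`, by AM–GM in polynomial form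
  set κ : ℝ := 27 * c ^ 4 / (256 * ν ^ 3) * Z ^ 3 with hκ
  have hκ0 : 0 ≤ κ := by positivity
  set q : ℝ := ν * P / 3 with hq
  have hq0 : 0 ≤ q := by positivity
  have hamgm : 256 * q ^ 3 * κ ≤ (3 * q + κ) ^ 4 := by
    have hid : (3 * q + κ) ^ 4 - 256 * q ^ 3 * κ = (q - κ) ^ 2 * (81 * q ^ 2 + 14 * q * κ + κ ^ 2) := by
      ring
    have hnn : 0 ≤ (q - κ) ^ 2 * (81 * q ^ 2 + 14 * q * κ + κ ^ 2) := by positivity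
    linarith
  have hcX4 : (c * X) ^ 4 = 256 * q ^ 3 * κ := by
    rw [mul_pow, hX4, hq, hκ]
    field_simp
    ring
  have h3q : 3 * q + κ = ν * P + κ := by rw [hq]; ring
  have hle4 : (c * X) ^ 4 ≤ (ν * P + κ) ^ 4 := by rw [hcX4, ← h3q]; exact hamgm
  have hcX : c * X ≤ ν * P + κ :=
    (pow_le_pow_iff_left₀ (by positivity) (by positivity) (by norm_num)).1 hle4
  have hκ2 : 2 * κ = 27 * c ^ 4 / (128 * ν ^ 3) * Z ^ 3 := by rw [hκ]; ring
  linarith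

/-- **Window algebra at an instant of `ε₀`-growth.** If `ε₀ Z³ ≤ 2S − 2νP` with `Z > 0`, `P ≥ 0` and the
envelope `|S| ≤ c Z^{3/4} P^{3/4}`, then `P > 0`, `νP ≤ S`, the palinstrophy ratio is pinned to the
Lu–Doering window `Z³ ≤ (2c/ε₀)^{4/3} P`, `ν⁴ P ≤ c⁴ Z³`, and the stretching is `ε₁`-efficient with
`ε₁ = ε₀ν³/(2c³)`: `ε₁ Z^{3/4} P^{3/4} ≤ S`. [folklore] -/
theorem window {c ν ε₀ Z P S : ℝ} (hc : 0 < c) (hν : 0 < ν) (hε₀ : 0 < ε₀) (hZ : 0 < Z)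
    (hP : 0 ≤ P) (henv : |S| ≤ c * Z ^ (3 / 4 : ℝ) * P ^ (3 / 4 : ℝ))
    (hgrow : ε₀ * Z ^ 3 ≤ 2 * S - 2 * ν * P) :
    0 < P ∧ ν * P ≤ S ∧ ν ^ 4 * P ≤ c ^ 4 * Z ^ 3 ∧ Z ^ 3 ≤ (2 * c / ε₀) ^ (4 / 3 : ℝ) * P ∧
      ε₀ * ν ^ 3 / (2 * c ^ 3) * Z ^ (3 / 4 : ℝ) * P ^ (3 / 4 : ℝ) ≤ S := by
  set X : ℝ := Z ^ (3 / 4 : ℝ) * P ^ (3 / 4 : ℝ) with hX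
  have hX0 : 0 ≤ X := by positivity
  have hX4 : X ^ 4 = Z ^ 3 * P ^ 3 := envelope_pow_four hZ.le hP
  have hSX : S ≤ c * X := by
    have := le_abs_self S
    rw [hX, ← mul_assoc]
    linarith
  have hZ3 : 0 < Z ^ 3 := pow_pos hZ 3
  have hεZ : 0 < ε₀ * Z ^ 3 := mul_pos hε₀ hZ3
  have hνP : 0 ≤ ν * P := mul_nonneg hν.le hP
  have hS1 : ν * P ≤ S := by linarith
  have hSpos : 0 < S := by linarith
  have hS2 : ε₀ * Z ^ 3 ≤ 2 * S := by linarith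
  -- `P > 0`
  have hPpos : 0 < P := by
    rcases hP.lt_or_eq with h | h
    · exact h
    · exfalso
      have hX0' : X = 0 := by
        rw [hX, ← h, Real.zero_rpow (by norm_num)]; ring
      rw [hX0'] at hSX
      linarith
  -- `ν⁴ P ≤ c⁴ Z³`
  have hνc : ν ^ 4 * P ≤ c ^ 4 * Z ^ 3 := by
    have h1 : (ν * P) ^ 4 ≤ (c * X) ^ 4 := pow_le_pow_left₀ hνP (hS1.trans hSX) 4
    rw [mul_pow, mul_pow, hX4] at h1
    -- `ν⁴ P⁴ ≤ c⁴ Z³ P³`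
    have hP3 : 0 < P ^ 3 := pow_pos hPpos 3
    have h2 : ν ^ 4 * P * P ^ 3 ≤ c ^ 4 * Z ^ 3 * P ^ 3 := by
      calc ν ^ 4 * P * P ^ 3 = ν ^ 4 * P ^ 4 := by ring
        _ ≤ c ^ 4 * (Z ^ 3 * P ^ 3) := h1
        _ = c ^ 4 * Z ^ 3 * P ^ 3 := by ring
    exact le_of_mul_le_mul_right h2 hP3
  -- `Z³ ≤ (2c/ε₀)^{4/3} P`
  set A : ℝ := (2 * c / ε₀) ^ (4 / 3 : ℝ) with hA
  have hce : 0 < 2 * c / ε₀ := by positivity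
  have hA0 : 0 ≤ A := by positivity
  have hA3 : A ^ 3 = (2 * c / ε₀) ^ 4 := by
    rw [hA, ← Real.rpow_natCast, ← Real.rpow_mul hce.le]
    norm_num
  have hwin : Z ^ 3 ≤ A * P := by
    have h1 : Z ^ 3 ≤ 2 * c / ε₀ * X := by
      rw [div_mul_eq_mul_div, le_div_iff₀ hε₀]
      linarith
    have h2 : (Z ^ 3) ^ 4 ≤ (2 * c / ε₀ * X) ^ 4 := pow_le_pow_left₀ hZ3.le h1 4
    rw [mul_pow, hX4] at h2
    -- `Z¹² ≤ (2c/ε₀)⁴ Z³ P³`, i.e. `(Z³)³ ≤ (A P)³`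
    have h3 : (Z ^ 3) ^ 3 * Z ^ 3 ≤ (A * P) ^ 3 * Z ^ 3 := by
      calc (Z ^ 3) ^ 3 * Z ^ 3 = (Z ^ 3) ^ 4 := by ring
        _ ≤ (2 * c / ε₀) ^ 4 * (Z ^ 3 * P ^ 3) := h2
        _ = (A * P) ^ 3 * Z ^ 3 := by rw [mul_pow, hA3]; ring
    have h4 : (Z ^ 3) ^ 3 ≤ (A * P) ^ 3 := le_of_mul_le_mul_right h3 hZ3
    exact (pow_le_pow_iff_left₀ hZ3.le (by positivity) (by norm_num)).1 h4
  -- efficiency `ε₁ X ≤ S`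
  have heff : ε₀ * ν ^ 3 / (2 * c ^ 3) * Z ^ (3 / 4 : ℝ) * P ^ (3 / 4 : ℝ) ≤ S := by
    have h1 : (ν ^ 4 * P) ^ 3 ≤ (c ^ 4 * Z ^ 3) ^ 3 := pow_le_pow_left₀ (by positivity) hνc 3
    -- `(ν³ X)⁴ ≤ (c³ Z³)⁴`
    have h2 : (ν ^ 3 * X) ^ 4 ≤ (c ^ 3 * Z ^ 3) ^ 4 := by
      have h3 : (ν ^ 3 * X) ^ 4 * 1 = ν ^ 12 * P ^ 3 * Z ^ 3 := by rw [mul_pow, hX4]; ring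
      have h4 : (c ^ 3 * Z ^ 3) ^ 4 = c ^ 12 * Z ^ 9 * Z ^ 3 := by ring
      have h5 : ν ^ 12 * P ^ 3 ≤ c ^ 12 * Z ^ 9 := by
        calc ν ^ 12 * P ^ 3 = (ν ^ 4 * P) ^ 3 := by ring
          _ ≤ (c ^ 4 * Z ^ 3) ^ 3 := h1
          _ = c ^ 12 * Z ^ 9 := by ring
      calc (ν ^ 3 * X) ^ 4 = ν ^ 12 * P ^ 3 * Z ^ 3 := by rw [← h3, mul_one]
        _ ≤ c ^ 12 * Z ^ 9 * Z ^ 3 := mul_le_mul_of_nonneg_right h5 hZ3.le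
        _ = (c ^ 3 * Z ^ 3) ^ 4 := h4.symm
    have h6 : ν ^ 3 * X ≤ c ^ 3 * Z ^ 3 :=
      (pow_le_pow_iff_left₀ (by positivity) (by positivity) (by norm_num)).1 h2
    have hc3 : 0 < c ^ 3 := pow_pos hc 3
    calc ε₀ * ν ^ 3 / (2 * c ^ 3) * Z ^ (3 / 4 : ℝ) * P ^ (3 / 4 : ℝ)
        = ε₀ / (2 * c ^ 3) * (ν ^ 3 * X) := by rw [hX]; ring
      _ ≤ ε₀ / (2 * c ^ 3) * (c ^ 3 * Z ^ 3) :=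
          mul_le_mul_of_nonneg_left h6 (by positivity)
      _ = ε₀ * Z ^ 3 / 2 := by field_simp
      _ ≤ S := by linarith
  exact ⟨hPpos, hS1, hνc, hwin, heff⟩

/-- **Radius comparison**: `Z³ ≤ A·P` with `Z, P > 0`, `A ≥ 0` gives `K√(Z/P) ≤ K√A / Z` for `K ≥ 0`
(the concentration ball of the structural lemma has radius `O(1/Z)`). [folklore] -/
theorem radius_le {A K Z P : ℝ} (hA : 0 ≤ A) (hK : 0 ≤ K) (hZ : 0 < Z) (hP : 0 < P)
    (hwin : Z ^ 3 ≤ A * P) : K * Real.sqrt (Z / P) ≤ K * Real.sqrt A / Z := by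
  have h1 : Z / P ≤ A / Z ^ 2 := by
    rw [div_le_div_iff₀ hP (pow_pos hZ 2)]
    nlinarith
  have h2 : Real.sqrt (Z / P) ≤ Real.sqrt A / Z := by
    calc Real.sqrt (Z / P) ≤ Real.sqrt (A / Z ^ 2) := Real.sqrt_le_sqrt h1
      _ = Real.sqrt A / Z := by rw [Real.sqrt_div hA, Real.sqrt_sq hZ.le]
  rw [mul_div_assoc]
  exact mul_le_mul_of_nonneg_left h2 hK

/-! ## 2. The mean-value recurrence for `g = Z⁻²` -/

/-- **Mean-value recurrence.** If `g` is differentiable on `[t,T)`, `g(t) > 0`, and `g` gets below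
`g(t)/4` somewhere in `(t,T)`, then at some `ξ ∈ (t,T)` the derivative is `≤ −g(t)/(2(T−t))`.
[folklore] -/
theorem exists_deriv_le {g g' : ℝ → ℝ} {t T : ℝ}
    (hder : ∀ s ∈ Ico t T, HasDerivAt g (g' s) s) (hpos : 0 < g t)
    (hlow : ∃ T' ∈ Ioo t T, g T' ≤ g t / 4) :
    ∃ ξ ∈ Ioo t T, g' ξ ≤ -(g t / (2 * (T - t))) := by
  obtain ⟨T', hT', hgT'⟩ := hlow
  have htT' : t < T' := hT'.1
  have hcont : ContinuousOn g (Icc t T') := fun s hs =>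
    (hder s ⟨hs.1, hs.2.trans_lt hT'.2⟩).continuousAt.continuousWithinAt
  have hder' : ∀ s ∈ Ioo t T', HasDerivAt g (g' s) s := fun s hs =>
    hder s ⟨hs.1.le, hs.2.trans hT'.2⟩
  obtain ⟨ξ, hξ, hslope⟩ := exists_hasDerivAt_eq_slope g g' htT' hcont hder'
  refine ⟨ξ, ⟨hξ.1, hξ.2.trans hT'.2⟩, ?_⟩
  rw [hslope]
  have h1 : 0 < T' - t := sub_pos.2 htT'
  have h2 : T' - t ≤ T - t := by linarith [hT'.2]
  have h3 : 0 < T - t := h1.trans_le h2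
  -- `(g T' − g t)/(T' − t) ≤ (−3 g t/4)/(T'−t) ≤ −g t/(2(T−t))`
  rw [div_le_iff₀ h1]
  have h4 : g t / (2 * (T - t)) * (T' - t) ≤ g t / 2 := by
    rw [div_mul_eq_mul_div, div_le_div_iff₀ (by positivity) two_pos]
    nlinarith
  linarith

end TypeIRecurrence

end Summit.NavierStokesRegularity.NavierStokesRegularity.Theorems

end
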